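import Summits.SmoothPoincare4.SmoothPoincare4.Theses.EntropyRung
import Summits.SmoothPoincare4.SmoothPoincare4.Theorems.EntropyRungNoncompactShrinkerGapCarrilloNiClauses
import Summits.SmoothPoincare4.SmoothPoincare4.Theorems.EntropyRungConicalGapStubWeightedIdentity
import Summits.SmoothPoincare4.SmoothPoincare4.Theorems.EntropyRungConicalGapStubWeightedIntegrability
import Summits.SmoothPoincare4.SmoothPoincare4.Theorems.EntropyRungConicalGapStubTransformFinite
import Summits.SmoothPoincare4.SmoothPoincare4.Theorems.EntropyRungConicalGapStubTransformLimit
import Literature.Geometry.Lorentzian.CurvatureRegularity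
import Literature.Geometry.Riemannian.PerelmanEntropyCutoff
import HarnessLib

/-!
# Crux `EntropyRung.ConicalGap` (stmt-SmoothPoincare4-16589), line `Sketch`: the density transform and the Reduction

The four analytic stubs of line `Sketch` (card `avr-window`) are landed
(`stub_weightedIntegrability` p127392, `stub_weightedIdentity` p127048, `stub_transformFinite` p127494,
`stub_transformLimit` p127115, all in this namespace). Composed, they give the **Gaussian-density transform of
Wang–Wang 2023** (arXiv:2308.06560, Prop. 2.6, (2.6)–(2.10): the Gaussian-volume function
`h(τ) = (4πτ)⁻² ∫ e^{-f/τ} dV` has `h′(τ) = (4π)⁻² τ⁻⁴ (1 − τ) ∫ R e^{-f/τ} dV`, integrated over `τ ∈ [1, ∞)`) as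
an unconditional theorem of the tree, on EVERY complete connected normalised 4-d gradient shrinking Ricci soliton
(`Ric + Hess f = g/2`, `R + |∇f|² = f`, closed `g`-balls compact):

  `∫ e^{-f} dV = 16π² · a + ∫ R(x) k(f(x)) dV(x)`,   `k(t) = ∫₁^∞ (τ − 1) τ⁻⁴ e^{-t/τ} dτ ≥ 0`,

where `a = lim_{T → ∞} (16π²T²)⁻¹ ∫ e^{-f/T} dV ≥ 0` exists (the regularised asymptotic volume ratio; `= AVR(g)` on the
asymptotically conical class, W–W (2.6)) and `R k(f)` is integrable — `helper_densityTransform`. Consequences filed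
here for the crux chain:

* `helper_avr_le_density` — `16π² a ≤ ∫ e^{-f} dV` (the regularised form of W–W Thm 1.1, `AVR ≤ Θ`);
* `helper_conicalGap_of_coreBudget` — **the Reduction**: the crux `ConicalGap` follows BY NAME from the one open
  stub of the line, the apex `stub_coreBudget` (its registered statement, verbatim, as the hypothesis):
  `16π² a + ∫ R k(f) dV ≤ 32π²√π e^{-3/2}` on the crux class (in `ℝ≥0∞`);
* `helper_coreBudget_of_conicalGap` — the converse (uniqueness of the limit `a`), so the apex is EXACTLY the crux in
  transformed coordinates: the line moves the whole difficulty into `CoreBudget` and splits nothing off it;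
* `helper_thinCone_of_conicalGap` — the card's necessary condition "shrinker cones are thin": `ConicalGap` forces
  `16π² a ≤ 32π²√π e^{-3/2}`, i.e. `a ≤ Θ(S³×ℝ) = 2√π e^{-3/2} ≈ .791` for the regularised AVR of every member of the
  crux class.

Everything here is proved; no definition and no named fact is introduced. `R ≥ 0` (Zhang 2009, `shrinkerScalarCurvature_nonneg_holds`)
and the properness of `f` are theorems of the tree and enter through the landed stubs.

## References

* Y. Wang, G. Wang, *arXiv:2308.06560* (2023), Thm 1.1, Prop. 2.6, (2.6)–(2.10).
* [CarrilloNi2009] J. Carrillo, L. Ni, Comm. Anal. Geom. 17 (2009) 721–753 (cut-off technique behind the stubs).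
-/

noncomputable section

-- `Summit.SmoothPoincare4.SmoothPoincare4.…` (summit = problem) trips `dupNamespace` on every decl.
set_option linter.dupNamespace false

open scoped Manifold ContDiff ENNReal NNReal Topology
open MeasureTheory Set Filter
open Literature.Geometry.Lorentzian Literature.Geometry.Riemannian

namespace Summit.SmoothPoincare4.SmoothPoincare4.Theorems.ConicalGapSketch

/-- The transform kernel `k(t) = ∫₁^∞ (τ − 1) τ⁻⁴ e^{-t/τ} dτ` is non-negative (integrand `≥ 0` on `τ > 1`). -/
theorem densityTransform_kernel_integral_nonneg (t : ℝ) :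
    0 ≤ ∫ τ in Set.Ioi (1 : ℝ), (τ - 1) / τ ^ 4 * Real.exp (-t / τ) :=
  setIntegral_nonneg measurableSet_Ioi fun τ hτ ↦
    mul_nonneg (div_nonneg (by linarith [show (1 : ℝ) < τ from hτ]) (by positivity)) (Real.exp_pos _).le

/-- **The Wang–Wang density transform** (arXiv:2308.06560, Prop. 2.6 integrated over `[1, ∞)`; composition of the
four landed stubs of line `Sketch`): on a complete connected normalised 4-d gradient shrinker there is `a ≥ 0` with
`(16π²T²)⁻¹ ∫ e^{-f/T} dV → a` (`T → ∞`), `R k(f) ∈ L¹(dV)`, and `∫ e^{-f} dV = 16π² a + ∫ R k(f) dV`,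
`k(t) = ∫₁^∞ (τ − 1) τ⁻⁴ e^{-t/τ} dτ`. -/
theorem helper_densityTransform : ∀ (M : Type) [TopologicalSpace M] [T2Space M] [SecondCountableTopology M] [ChartedSpace (EuclideanSpace ℝ (Fin 4)) M] [IsManifold (𝓡 4) ∞ M] [ConnectedSpace M] [T3Space M] [MeasurableSpace M] [BorelSpace M] (g : Literature.Geometry.Lorentzian.PseudoRiemannianMetric (𝓡 4) ∞ (EuclideanSpace ℝ (Fin 4)) (TangentSpace (𝓡 4) : M → Type _)) [g.HasLeviCivita] (f : M → ℝ) (hg : g.IsRiemannian), (∀ (x : M) (r : NNReal), IsCompact {y : M | g.edist hg x y ≤ r}) → ContMDiff (𝓡 4) 𝓘(ℝ, ℝ) ∞ f → (∀ (x : M) (X Y : TangentSpace (𝓡 4) x), g.ricci x X Y + g.hessian f x X Y = (1 / 2 : ℝ) * g.val x X Y) → (∀ x : M, g.scalarCurvature x + g.gradSq f x = f x) → ∃ a : ℝ, 0 ≤ a ∧ Filter.Tendsto (fun T : ℝ ↦ (16 * Real.pi ^ 2 * T ^ 2)⁻¹ * ∫ x, Real.exp (-f x / T) ∂(Literature.Geometry.Lorentzian.riemannianMeasure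 (g.toContMDiffRiemannianMetric hg))) Filter.atTop (nhds a) ∧ MeasureTheory.Integrable (fun x ↦ g.scalarCurvature x * ∫ τ in Set.Ioi (1 : ℝ), (τ - 1) / τ ^ 4 * Real.exp (-f x / τ)) (Literature.Geometry.Lorentzian.riemannianMeasure (g.toContMDiffRiemannianMetric hg)) ∧ ∫ x, Real.exp (-f x) ∂(Literature.Geometry.Lorentzian.riemannianMeasure (g.toContMDiffRiemannianMetric hg)) = 16 * Real.pi ^ 2 * a + ∫ x, g.scalarCurvature x * (∫ τ in Set.Ioi (1 : ℝ), (τ - 1) / τ ^ 4 * Real.exp (-f x / τ)) ∂(Literature.Geometry.Lorentzian.riemannianMeasure (g.toContMDiffRiemannianMetric hg)) := by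
  intro M _ _ _ _ _ _ _ _ _ g _ f hg hc hf hsol hnorm
  -- `R ≥ 0`, `f ≥ 0`, continuity of `R`
  have hR0 : ∀ x, 0 ≤ g.scalarCurvature x :=
    shrinkerScalarCurvature_nonneg_holds 4 M g f hg hc hf hsol hnorm
  have hf0 : ∀ x, 0 ≤ f x := fun x ↦ by
    have h1 := hnorm x
    have h2 := g.gradSq_nonneg hg f x
    linarith [hR0 x]
  have hRc : Continuous fun x ↦ g.scalarCurvature x :=
    (PseudoRiemannianMetric.contMDiff_scalarCurvature g).continuous
  -- measure-theoretic instances for `dV`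
  haveI : LocallyCompactSpace M := Manifold.locallyCompact_of_finiteDimensional (M := M) (𝓡 4)
  haveI : IsFiniteMeasureOnCompacts (riemannianMeasure (g.toContMDiffRiemannianMetric hg)) := by
    have h := CarrilloNi2009_shrinkerLSI.isFiniteMeasureOnCompacts_riemVolume hg
    rwa [PseudoRiemannianMetric.riemVolume_eq hg] at h
  haveI : IsLocallyFiniteMeasure (riemannianMeasure (g.toContMDiffRiemannianMetric hg)) :=
    isLocallyFiniteMeasure_of_isFiniteMeasureOnCompacts
  haveI : SigmaFinite (riemannianMeasure (g.toContMDiffRiemannianMetric hg)) := by infer_instance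
  -- the chain of landed stubs
  have hA := stub_weightedIntegrability M g f hg hc hf hsol hnorm
  have hB := stub_weightedIdentity M g f hg hc hf hsol hnorm hA
  have hC := stub_transformFinite M (riemannianMeasure (g.toContMDiffRiemannianMetric hg)) f
    (fun x ↦ g.scalarCurvature x) hf.continuous hRc hf0 hR0 hA hB
  exact stub_transformLimit M (riemannianMeasure (g.toContMDiffRiemannianMetric hg)) f
    (fun x ↦ g.scalarCurvature x) hf.continuous hRc hf0 hR0 hA hC

/-- **`16π² a ≤ ∫ e^{-f} dV`** — the regularised asymptotic volume ratio is dominated by the Gaussian mass (the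
integrated form of Wang–Wang 2023 Thm 1.1, `AVR ≤ Θ`): immediate from `helper_densityTransform` and `R k(f) ≥ 0`. -/
theorem helper_avr_le_density : ∀ (M : Type) [TopologicalSpace M] [T2Space M] [SecondCountableTopology M] [ChartedSpace (EuclideanSpace ℝ (Fin 4)) M] [IsManifold (𝓡 4) ∞ M] [ConnectedSpace M] [T3Space M] [MeasurableSpace M] [BorelSpace M] (g : Literature.Geometry.Lorentzian.PseudoRiemannianMetric (𝓡 4) ∞ (EuclideanSpace ℝ (Fin 4)) (TangentSpace (𝓡 4) : M → Type _)) [g.HasLeviCivita] (f : M → ℝ) (hg : g.IsRiemannian), (∀ (x : M) (r : NNReal), IsCompact {y : M | g.edist hg x y ≤ r}) → ContMDiff (𝓡 4) 𝓘(ℝ, ℝ) ∞ f → (∀ (x : M) (X Y : TangentSpace (𝓡 4) x), g.ricci x X Y + g.hessian f x X Y = (1 / 2 : ℝ) * g.val x X Y) → (∀ x : M, g.scalarCurvature x + g.gradSq f x = f x) → ∀ a : ℝ, Filter.Tendsto (fun T : ℝ ↦ (16 * Real.pi ^ 2 * T ^ 2)⁻¹ * ∫ x, Real.exp (-f x / T)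 ∂(Literature.Geometry.Lorentzian.riemannianMeasure (g.toContMDiffRiemannianMetric hg))) Filter.atTop (nhds a) → 16 * Real.pi ^ 2 * a ≤ ∫ x, Real.exp (-f x) ∂(Literature.Geometry.Lorentzian.riemannianMeasure (g.toContMDiffRiemannianMetric hg)) := by
  intro M _ _ _ _ _ _ _ _ _ g _ f hg hc hf hsol hnorm a ha
  have hR0 : ∀ x, 0 ≤ g.scalarCurvature x :=
    shrinkerScalarCurvature_nonneg_holds 4 M g f hg hc hf hsol hnorm
  obtain ⟨a', -, hlim, -, hZ⟩ := helper_densityTransform M g f hg hc hf hsol hnorm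
  have haa : a = a' := tendsto_nhds_unique ha hlim
  subst haa
  rw [hZ]
  have hker : ∀ x, 0 ≤ g.scalarCurvature x *
      ∫ τ in Set.Ioi (1 : ℝ), (τ - 1) / τ ^ 4 * Real.exp (-f x / τ) :=
    fun x ↦ mul_nonneg (hR0 x) (densityTransform_kernel_integral_nonneg (f x))
  have hI : 0 ≤ ∫ x, g.scalarCurvature x *
      (∫ τ in Set.Ioi (1 : ℝ), (τ - 1) / τ ^ 4 * Real.exp (-f x / τ))
      ∂(riemannianMeasure (g.toContMDiffRiemannianMetric hg)) :=
    integral_nonneg hker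
  linarith

/-- **The Reduction `ConicalGap ⇐ CoreBudget`**: the crux BY NAME from the apex stub of line `Sketch` (its registered
statement verbatim as the hypothesis): with `a` from `helper_densityTransform`,
`∫⁻ ofReal(e^{-f}) = ofReal(∫ e^{-f}) = ofReal(16π² a) + ∫⁻ ofReal(R k(f)) ≤ 32π²√π e^{-3/2}`. -/
theorem helper_conicalGap_of_coreBudget : (∀ (M : Type) [TopologicalSpace M] [T2Space M] [SecondCountableTopology M] [ChartedSpace (EuclideanSpace ℝ (Fin 4)) M] [IsManifold (𝓡 4) ∞ M] [ConnectedSpace M] [NoncompactSpace M] [T3Space M] [MeasurableSpace M] [BorelSpace M] (g : Literature.Geometry.Lorentzian.PseudoRiemannianMetric (𝓡 4) ∞ (EuclideanSpace ℝ (Fin 4)) (TangentSpace (𝓡 4) : M → Type _)) [g.HasLeviCivita] (f : M → ℝ) (hg : g.IsRiemannian), (∀ (x : M) (r : NNReal), IsCompact {y : M | g.edist hg x y ≤ r}) → ContMDiff (𝓡 4) 𝓘(ℝ, ℝ) ∞ f → (∀ (x : M) (X Y : TangentSpace (𝓡 4) x), g.ricci x X Y + g.hessian f x X Y = (1 / 2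 : ℝ) * g.val x X Y) → (∀ x : M, g.scalarCurvature x + g.gradSq f x = f x) → (∃ x : M, g.scalarCurvature x ≠ 0) → (∀ ε : ℝ, 0 < ε → ∃ K : Set M, IsCompact K ∧ ∀ x, x ∉ K → g.scalarCurvature x < ε) → ∀ a : ℝ, Filter.Tendsto (fun T : ℝ ↦ (16 * Real.pi ^ 2 * T ^ 2)⁻¹ * ∫ x, Real.exp (-f x / T) ∂(Literature.Geometry.Lorentzian.riemannianMeasure (g.toContMDiffRiemannianMetric hg))) Filter.atTop (nhds a) → ENNReal.ofReal (16 * Real.pi ^ 2 * a) + ∫⁻ x, ENNReal.ofReal (g.scalarCurvature x * ∫ τ in Set.Ioi (1 : ℝ), (τ - 1) / τ ^ 4 * Real.exp (-f x / τ)) ∂(Literature.Geometry.Lorentzian.riemannianMeasure (g.toContMDiffRiemannianMetric hg)) ≤ ENNReal.ofReal (32 * Real.pi ^ 2 * Real.sqrt Real.pi * Real.exp (-(3 : ℝ) / 2))) → Summit.SmoothPoincare4.SmoothPoincare4.Theses.EntropyRung.ConicalGap := by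
  intro hbudget M _ _ _ _ _ _ _ _ _ _ g _ f hg hc hf hsol hnorm hnf hdec
  have hR0 : ∀ x, 0 ≤ g.scalarCurvature x :=
    shrinkerScalarCurvature_nonneg_holds 4 M g f hg hc hf hsol hnorm
  obtain ⟨a, ha, hlim, hint, hZ⟩ := helper_densityTransform M g f hg hc hf hsol hnorm
  have hb := hbudget M g f hg hc hf hsol hnorm hnf hdec a hlim
  obtain ⟨hI1, -, -⟩ := stub_weightedIntegrability M g f hg hc hf hsol hnorm 1 one_pos
  have hI1' : Integrable (fun x ↦ Real.exp (-f x))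
      (riemannianMeasure (g.toContMDiffRiemannianMetric hg)) := by
    simpa only [div_one] using hI1
  have hker : ∀ x, 0 ≤ g.scalarCurvature x *
      ∫ τ in Set.Ioi (1 : ℝ), (τ - 1) / τ ^ 4 * Real.exp (-f x / τ) :=
    fun x ↦ mul_nonneg (hR0 x) (densityTransform_kernel_integral_nonneg (f x))
  have ha0 : 0 ≤ 16 * Real.pi ^ 2 * a := by positivity
  calc ∫⁻ x, ENNReal.ofReal (Real.exp (-f x)) ∂(riemannianMeasure (g.toContMDiffRiemannianMetric hg))
      = ENNReal.ofReal (∫ x, Real.exp (-f x) ∂(riemannianMeasure (g.toContMDiffRiemannianMetric hg))) :=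
        (ofReal_integral_eq_lintegral_ofReal hI1' (ae_of_all _ fun x ↦ (Real.exp_pos _).le)).symm
    _ = ENNReal.ofReal (16 * Real.pi ^ 2 * a) +
          ∫⁻ x, ENNReal.ofReal (g.scalarCurvature x *
            ∫ τ in Set.Ioi (1 : ℝ), (τ - 1) / τ ^ 4 * Real.exp (-f x / τ))
            ∂(riemannianMeasure (g.toContMDiffRiemannianMetric hg)) := by
        rw [hZ, ENNReal.ofReal_add ha0 (integral_nonneg hker),
          ofReal_integral_eq_lintegral_ofReal hint (ae_of_all _ hker)]
    _ ≤ ENNReal.ofReal (32 * Real.pi ^ 2 * Real.sqrt Real.pi * Real.exp (-(3 : ℝ) / 2)) := hb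

/-- **The converse `CoreBudget ⇐ ConicalGap`** (uniqueness of the limit `a`): the apex of line `Sketch` is EXACTLY
the crux in transformed coordinates — nothing is split off. -/
theorem helper_coreBudget_of_conicalGap : Summit.SmoothPoincare4.SmoothPoincare4.Theses.EntropyRung.ConicalGap → (∀ (M : Type) [TopologicalSpace M] [T2Space M] [SecondCountableTopology M] [ChartedSpace (EuclideanSpace ℝ (Fin 4)) M] [IsManifold (𝓡 4) ∞ M] [ConnectedSpace M] [NoncompactSpace M] [T3Space M] [MeasurableSpace M] [BorelSpace M] (g : Literature.Geometry.Lorentzian.PseudoRiemannianMetric (𝓡 4) ∞ (EuclideanSpace ℝ (Fin 4)) (TangentSpace (𝓡 4) : M → Type _)) [g.HasLeviCivita] (f : M → ℝ) (hg : g.IsRiemannian), (∀ (x : M) (r : NNReal), IsCompact {y : M | g.edist hg x y ≤ r}) → ContMDiff (𝓡 4) 𝓘(ℝ, ℝ) ∞ f → (∀ (x : M) (X Y : TangentSpace (𝓡 4) x), g.ricci x X Y + g.hessian f x X Y = (1 / 2 : ℝ) * g.val x X Y) → (∀ x : M, g.scalarCurvature x + g.gradSq f x = f x) → (∃ x : M,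 g.scalarCurvature x ≠ 0) → (∀ ε : ℝ, 0 < ε → ∃ K : Set M, IsCompact K ∧ ∀ x, x ∉ K → g.scalarCurvature x < ε) → ∀ a : ℝ, Filter.Tendsto (fun T : ℝ ↦ (16 * Real.pi ^ 2 * T ^ 2)⁻¹ * ∫ x, Real.exp (-f x / T) ∂(Literature.Geometry.Lorentzian.riemannianMeasure (g.toContMDiffRiemannianMetric hg))) Filter.atTop (nhds a) → ENNReal.ofReal (16 * Real.pi ^ 2 * a) + ∫⁻ x, ENNReal.ofReal (g.scalarCurvature x * ∫ τ in Set.Ioi (1 : ℝ), (τ - 1) / τ ^ 4 * Real.exp (-f x / τ)) ∂(Literature.Geometry.Lorentzian.riemannianMeasure (g.toContMDiffRiemannianMetric hg)) ≤ ENNReal.ofReal (32 * Real.pi ^ 2 * Real.sqrt Real.pi * Real.exp (-(3 : ℝ) / 2))) := by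
  intro hgap M _ _ _ _ _ _ _ _ _ _ g _ f hg hc hf hsol hnorm hnf hdec a ha
  have hR0 : ∀ x, 0 ≤ g.scalarCurvature x :=
    shrinkerScalarCurvature_nonneg_holds 4 M g f hg hc hf hsol hnorm
  obtain ⟨a', ha', hlim, hint, hZ⟩ := helper_densityTransform M g f hg hc hf hsol hnorm
  have haa : a = a' := tendsto_nhds_unique ha hlim
  subst haa
  have h := hgap M g f hg hc hf hsol hnorm hnf hdec
  obtain ⟨hI1, -, -⟩ := stub_weightedIntegrability M g f hg hc hf hsol hnorm 1 one_pos
  have hI1' : Integrable (fun x ↦ Real.exp (-f x))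
      (riemannianMeasure (g.toContMDiffRiemannianMetric hg)) := by
    simpa only [div_one] using hI1
  have hker : ∀ x, 0 ≤ g.scalarCurvature x *
      ∫ τ in Set.Ioi (1 : ℝ), (τ - 1) / τ ^ 4 * Real.exp (-f x / τ) :=
    fun x ↦ mul_nonneg (hR0 x) (densityTransform_kernel_integral_nonneg (f x))
  have ha0 : 0 ≤ 16 * Real.pi ^ 2 * a := by positivity
  calc ENNReal.ofReal (16 * Real.pi ^ 2 * a) +
        ∫⁻ x, ENNReal.ofReal (g.scalarCurvature x *
          ∫ τ in Set.Ioi (1 : ℝ), (τ - 1) / τ ^ 4 * Real.exp (-f x / τ))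
          ∂(riemannianMeasure (g.toContMDiffRiemannianMetric hg))
      = ENNReal.ofReal (∫ x, Real.exp (-f x) ∂(riemannianMeasure (g.toContMDiffRiemannianMetric hg))) := by
        rw [hZ, ENNReal.ofReal_add ha0 (integral_nonneg hker),
          ofReal_integral_eq_lintegral_ofReal hint (ae_of_all _ hker)]
    _ = ∫⁻ x, ENNReal.ofReal (Real.exp (-f x)) ∂(riemannianMeasure (g.toContMDiffRiemannianMetric hg)) :=
        ofReal_integral_eq_lintegral_ofReal hI1' (ae_of_all _ fun x ↦ (Real.exp_pos _).le)
    _ ≤ ENNReal.ofReal (32 * Real.pi ^ 2 * Real.sqrt Real.pi * Real.exp (-(3 : ℝ) / 2)) := h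

/-- **"Shrinker cones are thin"** (card `avr-window`, necessary condition): `ConicalGap` forces the regularised
asymptotic volume ratio of every member of the crux class to satisfy `16π² a ≤ 32π²√π e^{-3/2}`
(`a ≤ Θ(S³×ℝ) = 2√π e^{-3/2}`), by `helper_avr_le_density`. -/
theorem helper_thinCone_of_conicalGap : Summit.SmoothPoincare4.SmoothPoincare4.Theses.EntropyRung.ConicalGap → ∀ (M : Type) [TopologicalSpace M] [T2Space M] [SecondCountableTopology M] [ChartedSpace (EuclideanSpace ℝ (Fin 4)) M] [IsManifold (𝓡 4) ∞ M] [ConnectedSpace M] [NoncompactSpace M] [T3Space M] [MeasurableSpace M] [BorelSpace M] (g : Literature.Geometry.Lorentzian.PseudoRiemannianMetric (𝓡 4) ∞ (EuclideanSpace ℝ (Fin 4)) (TangentSpace (𝓡 4) : M → Type _)) [g.HasLeviCivita] (f : M → ℝ) (hg : g.IsRiemannian), (∀ (x : M) (r : NNReal), IsCompact {y : M | g.edist hg x y ≤ r}) → ContMDiff (𝓡 4) 𝓘(ℝ, ℝ) ∞ f → (∀ (x : M) (X Y : TangentSpace (𝓡 4) x), g.ricci x X Y + g.hessian f x X Y =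 (1 / 2 : ℝ) * g.val x X Y) → (∀ x : M, g.scalarCurvature x + g.gradSq f x = f x) → (∃ x : M, g.scalarCurvature x ≠ 0) → (∀ ε : ℝ, 0 < ε → ∃ K : Set M, IsCompact K ∧ ∀ x, x ∉ K → g.scalarCurvature x < ε) → ∀ a : ℝ, Filter.Tendsto (fun T : ℝ ↦ (16 * Real.pi ^ 2 * T ^ 2)⁻¹ * ∫ x, Real.exp (-f x / T) ∂(Literature.Geometry.Lorentzian.riemannianMeasure (g.toContMDiffRiemannianMetric hg))) Filter.atTop (nhds a) → 16 * Real.pi ^ 2 * a ≤ 32 * Real.pi ^ 2 * Real.sqrt Real.pi * Real.exp (-(3 : ℝ) / 2) := by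
  intro hgap M _ _ _ _ _ _ _ _ _ _ g _ f hg hc hf hsol hnorm hnf hdec a ha
  have h16 := helper_avr_le_density M g f hg hc hf hsol hnorm a ha
  have h := hgap M g f hg hc hf hsol hnorm hnf hdec
  obtain ⟨hI1, -, -⟩ := stub_weightedIntegrability M g f hg hc hf hsol hnorm 1 one_pos
  have hI1' : Integrable (fun x ↦ Real.exp (-f x))
      (riemannianMeasure (g.toContMDiffRiemannianMetric hg)) := by
    simpa only [div_one] using hI1
  rw [← ofReal_integral_eq_lintegral_ofReal hI1' (ae_of_all _ fun x ↦ (Real.exp_pos _).le),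
    ENNReal.ofReal_le_ofReal_iff (by positivity)] at h
  exact h16.trans h

end Summit.SmoothPoincare4.SmoothPoincare4.Theorems.ConicalGapSketch

end
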